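import Literature.Computability.Complexity.GateEliminationCase54Affine

/-!
# Gate elimination: the affine leaf of Case 5.4.1.1.3 of Li–Yang's Theorem 4.1

"If `B` is an ⊕-type gate, then we can substitute `x ← t ⊕ c` such that the output of `B` is
fixed regardless of the inputs. This allows us to replace `B` by a constant. If `c` is chosen
appropriately, we can even trivialize `E`, further removing `D` and `G` by Rule 1, and degenerate
the descendent of `E` by Rule 3. Notice that only `t` and the other input of the descendent of `E`
can introduce troubled gates (`y` and `z` will not since they are `2`-variable), hence we have
`Δμ ≥ α_I + 5 - 2α_φ ≥ δ`." (ECCC TR21-023, §4.1, Case 5.4.1.1.3.) PROVED here as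
`stepGoal_affine_BD` in the local form used by the Case 5.4 dispatcher (hypothesis `hF3` of
`LiYang2022_case5_4_holds_aux`), with the bound `Δμ ≥ 5 - 3α_φ + α_I ≥ δ`.

## References

* J. Li, T. Yang, *3.1n − o(n) circuit lower bounds for explicit functions*, STOC 2022;
  ECCC TR21-023, §2.4 (affine substitution), §4.1 (Case 5.4.1.1.3), Lemma 3.11.
-/

namespace Literature.Computability.Complexity

open Finset

namespace Semicircuit

variable {n : ℕ} {C : Semicircuit n} {f : (Fin n → ZMod 2) → Bool} {R : RdqSource n} {d : ℕ}
  {αφ αI αQ : ℝ} {G : Fin C.m} {x y : Fin n} {B C' D : Fin C.m} {aX aB aC aD : Fin 2}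

/-- **Case 5.4.1.1.3 of the proof of Thm. 4.1** (the affine substitution `x ← t ⊕ c` when the
∧-type `1`-gate `E` reads `D` and the ⊕-type `B`): `B` reads `x` and the variable `t`; `E` reads
`D` (at `aE`) and `B`; `D` is a `1`-gate reading `G` and the `2`-variable `u`;
`fanout(t) + fanout(B) = 3`. Then `x ← t ⊕ c` makes `B` a constant trivializing `E`; eliminate
`B`, `E`, then the `0`-gates `D` and `G` (Rule 1, no potential increase), and the reader of `E`
(fed by a constant): `Δμ ≥ 5 - 3α_φ + α_I ≥ δ`. [cite: LiYang2022, §4.1 (Case 5.4.1.1.3), §2.4] -/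
theorem stepGoal_affine_BD (hf : IsAffineDisperser f d) (hd : 2 * d + 2 < R.dim) (hF : C.Fair)
    (hC : C.ComputesRestr f R) (hS : C.Standing R) (hcfg : C.Case5Config G x y B C' D aX aB aC aD)
    (hφ : 0 ≤ αφ) (hI : 0 ≤ αI) (αQ : ℝ) (hBC : B ≠ C')
    {E : Fin C.m} {aE : Fin 2} {t u : Fin n} (hBn : ¬ IsAndOp (C.op B)) (hBt : C.arg B aB.rev = .var t)
    (hEand : IsAndOp (C.op E)) (hED : C.arg E aE = .gate D) (hEB : C.arg E aE.rev = .gate B) (hE1 : C.fanout (.gate E) = 1)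
    (hIu : C.arg D aD.rev = .var u) (hsum : C.fanout (.var t) + C.fanout (.gate B) = 3) (hu2 : C.fanout (.var u) = 2)
    (hD1 : C.fanout (.gate D) = 1) :
    C.StepGoal f R αφ αI αQ := by
  classical
  have hN := hS.normalized.1
  have hBx := hcfg.arg_B
  obtain ⟨eB, heB⟩ : IsXorOp (C.op B) := C.isXorOp_of_isAffineOp hS.nonDegenerate ((isAndOp_or_isAffineOp _).resolve_left hBn)
  have hEK : E ∉ C.xorPart := C.not_mem_xorPart_of_isAndOp hEand
  have hGK := hcfg.G_not_mem
  have hDK : D ∉ C.xorPart := fun hDK => hGK (C.mem_of_arg_eq D hDK aD G hcfg.arg_D)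
  have hxt : x ≠ t := by
    intro h
    have e : ∀ a', C.arg B a' = .var x := fun a' => by
      rcases fin2_eq_or_eq_rev aB a' with h' | h'
      · rw [h']; exact hBx
      · rw [h', hBt, h]
    exact hN.arg_zero_ne_arg_one B (by rw [e 0, e 1])
  have hty : t ≠ y := fun h => case5_B_not_y hcfg hBC aB.rev (by rw [hBt, h])
  have hux : u ≠ x := fun h => case5_D_not_x hS hcfg aD.rev (by rw [hIu, h])
  have huy : u ≠ y := fun h => case5_D_not_y hS hcfg aD.rev (by rw [hIu, h])
  have hED' : E ≠ D := fun h => by rw [h] at hED; exact C.arg_ne_self_of_not_mem hDK _ hED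
  have hEB' : E ≠ B := by
    intro h; rw [h] at hED
    rcases fin2_eq_or_eq_rev aB aE with e | e
    · rw [e, hBx] at hED; cases hED
    · rw [e, hBt] at hED; cases hED
  have hEG : E ≠ G := by
    intro h; rw [h] at hED
    rcases fin2_eq_or_eq_rev aX aE with e' | e'
    · rw [e', hcfg.arg_G_x] at hED; cases hED
    · rw [e', hcfg.arg_G_y] at hED; cases hED
  have hE_x : ∀ a, C.arg E a ≠ .var x := by
    intro a h
    rcases fin2_eq_or_eq_rev aE a with e' | e'
    · rw [e', hED] at h; cases h
    · rw [e', hEB] at h; cases h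
  have hG_x1 : ∀ a, C.arg G a = .var x → a = aX := by
    intro a h
    rcases fin2_eq_or_eq_rev aX a with e' | e'
    · exact e'
    · rw [e', hcfg.arg_G_y] at h; cases h; exact absurd rfl hcfg.x_ne_y
  have hDout : C.out ≠ .gate D := out_ne_of_read_bYacyclic hS hEK ⟨aE, hED⟩
  have hGout : C.out ≠ .gate G := out_ne_of_read_bYacyclic hS hDK ⟨aD, hcfg.arg_D⟩
  -- the reader `H` of `E`
  obtain ⟨H, aH, hHE⟩ := exists_reader_of_fanout_pos (D := C) (by omega : 0 < C.fanout (.gate E))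
  have hHE' : H ≠ E := fun h => by rw [h] at hHE; exact C.arg_ne_self_of_not_mem hEK _ hHE
  have hHB : H ≠ B := by
    intro h; rw [h] at hHE
    rcases fin2_eq_or_eq_rev aB aH with e' | e'
    · rw [e', hBx] at hHE; cases hHE
    · rw [e', hBt] at hHE; cases hHE
  have hHD : H ≠ D := by
    intro h; rw [h] at hHE
    rcases fin2_eq_or_eq_rev aD aH with e' | e'
    · rw [e', hcfg.arg_D] at hHE; cases hHE; exact hEG rfl
    · rw [e', hIu] at hHE; cases hHE
  have hHG : H ≠ G := by
    intro h; rw [h] at hHE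
    rcases fin2_eq_or_eq_rev aX aH with e' | e'
    · rw [e', hcfg.arg_G_x] at hHE; cases hHE
    · rw [e', hcfg.arg_G_y] at hHE; cases hHE
  -- the killing value of `E`'s wire to `B`, and the constant of `B` after the substitution
  obtain ⟨kE, hkE⟩ := exists_trivializing hEand aE.rev
  let b : Bool := kE ^^ eB
  have hcB : ∀ s, (C.substVar x t b).op B s s = kE := by
    intro s
    rw [C.substVar_op_self (fun h => hxt h.symm) hBx hBt]
    split_ifs <;> rw [heB] <;> cases s <;> cases kE <;> cases eB <;> rfl
  -- the source after `x := t ⊕ b`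
  have hx : R.Free x := case5_free_x hC hcfg
  have hxp : ¬ R.Protected x := case5_unprot_x hS hcfg
  have ht : R.Free t := free_of_reads hC hBt
  have hxinf : x ∈ C.influential R := C.mem_influential_of_reads R hBx
  have htinf : t ∈ C.influential R := C.mem_influential_of_reads R hBt
  let c' : ZMod 2 := finTwoEquiv.symm b
  have hb' : finTwoEquiv c' = b := finTwoEquiv.apply_symm_apply b
  let Eq : LinEq n := ⟨{t}, c'⟩
  have hEq : ∀ i ∈ Eq.support, R.lin i = none ∧ i ≠ x := by
    intro i hi
    have : i = t := by simpa [Eq] using hi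
    subst this
    exact ⟨ht.1, fun h => hxt h.symm⟩
  let R₁ := R.assignLin x Eq hx hxp hEq
  have hsol : ∀ v, v ∈ R₁.Sol ↔ v ∈ R.Sol ∧ v x = v t + c' := by
    intro v
    rw [RdqSource.mem_sol_assignLin_iff]
    have : Eq.eval v = v t + c' := by
      show c' + ∑ i ∈ ({t} : Finset (Fin n)), v i = _
      rw [sum_singleton, add_comm]
    rw [this]
  have hfree : ∀ i, R₁.Free i ↔ R.Free i ∧ i ≠ x := RdqSource.free_assignLin_iff hx hxp hEq
  obtain ⟨ko, hko⟩ := exists_out_eq_gate' hf hF hC (by omega)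
  have hout : C.out ≠ .var x := by rw [hko]; exact fun h => by cases h
  have hd₁ : 2 * d + 2 ≤ R₁.dim := by
    have := RdqSource.dim_assignLin hx hxp hEq
    show 2 * d + 2 ≤ (R.assignLin x Eq hx hxp hEq).dim; omega
  -- the circuit after `x := t ⊕ b`
  let C₁ := C.substVar x t (finTwoEquiv c')
  have hF₁ : C₁.Fair := hF.substVar x t _
  have hC₁ : C₁.ComputesRestr f R₁ := hC.substVar (fun h => hxt h.symm) hsol hfree ht hout
  have hfant₁ : C₁.fanout (.var t) = C.fanout (.var t) + 2 := by
    show (C.substVar x t (finTwoEquiv c')).fanout (.var t) = _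
    rw [C.fanout_substVar_var_target x t _ (fun h => hxt h.symm), hcfg.fanout_x]
  have ht1 : 1 ≤ C.fanout (.var t) := one_le_fanout_of_arg_eq hBt
  obtain ⟨P₁, hP₁, hpot₁⟩ := exists_packing_substVar_noNew C x t (finTwoEquiv c') (fun h => hxt h.symm) C.isPacking_empty
    (by change 3 ≤ C₁.fanout (.var t); omega)
  have hC₁out : C₁.out = .gate ko := by show C.out.substVar x t = _; rw [hko]; rfl
  -- wires of `C₁`
  have hwB : ∀ a, C₁.arg B a = .var t := by
    intro a
    show (C.arg B a).substVar x t = .var t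
    rw [Node.substVar_eq_var_target_iff]
    rcases fin2_eq_or_eq_rev aB a with e' | e'
    · rw [e']; exact Or.inl hBx
    · rw [e']; exact Or.inr hBt
  have hgate₁ : ∀ {k : Fin C.m} {a : Fin 2} {g : Fin C.m}, C₁.arg k a = .gate g ↔ C.arg k a = .gate g :=
    fun {k a g} => Node.substVar_eq_gate_iff
  have hvar₁ : ∀ (k : Fin C.m) (a : Fin 2) (v : Fin n), v ≠ x → v ≠ t → (C₁.arg k a = .var v ↔ C.arg k a = .var v) :=
    fun k a v hvx hvt => Node.substVar_eq_var_iff_of_ne hvx hvt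
  have hEB₁ : C₁.arg E aE.rev = .gate B := hgate₁.mpr hEB
  have hED₁ : C₁.arg E aE = .gate D := hgate₁.mpr hED
  have hDG₁ : C₁.arg D aD = .gate G := hgate₁.mpr hcfg.arg_D
  have hHE₁ : C₁.arg H aH = .gate E := hgate₁.mpr hHE
  have hGt₁ : C₁.arg G aX = .var t := by
    show (C.arg G aX).substVar x t = .var t; rw [Node.substVar_eq_var_target_iff]; exact Or.inl hcfg.arg_G_x
  have hGy₁ : C₁.arg G aX.rev = .var y := by
    show (C.arg G aX.rev).substVar x t = .var y; rw [hcfg.arg_G_y]; exact Node.substVar_var_of_ne (fun h => hcfg.x_ne_y h.symm) t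
  have hDu₁ : C₁.arg D aD.rev = .var u ∨ (u = t) := by
    by_cases hut : u = t
    · exact Or.inr hut
    · left; exact (hvar₁ D aD.rev u hux hut).mpr hIu
  have hopE : ∀ p q, C₁.op E p q = C.op E p q := by
    intro p q
    show C.op E (p ^^ (finTwoEquiv c' && decide (C.arg E 0 = .var x))) (q ^^ (finTwoEquiv c' && decide (C.arg E 1 = .var x))) = _
    rw [decide_eq_false (hE_x 0), decide_eq_false (hE_x 1), Bool.and_false, Bool.xor_false, Bool.xor_false]
  -- step 1: `B` is the constant `kE`
  have hid : ∀ (xx : Fin n → Bool) (w : Fin C₁.m → Bool),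
      C₁.op B (C₁.nodeVal xx w (C₁.arg B 0)) (C₁.nodeVal xx w (C₁.arg B 1)) = kE := by
    intro xx w
    rw [hwB 0, hwB 1]
    show (C.substVar x t (finTwoEquiv c')).op B (xx t) (xx t) = kE
    rw [hb']; exact hcB _
  have hselfB : ∀ a, C₁.arg B a ≠ .gate B := by intro a h; rw [hwB a] at h; cases h
  have houtB : C₁.out ≠ .gate B :=
    out_ne_of_semConst hf (by omega) hF₁ hC₁ (fun xx w hw => by rw [hw B]; exact hid xx w)
  let E₁ := elimDataWRedirectConst hF₁ hC₁ hP₁ kE hid (Or.inl (by rw [hwB 0, hwB 1])) hselfB houtB hφ hI αQ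
  have hrepl₁ : E₁.repl = .const kE := rfl
  obtain ⟨kE₁, hkE₁⟩ := E₁.ι_surj E hEB'
  obtain ⟨kD₁, hkD₁⟩ := E₁.ι_surj D (case5_B_ne_D hS hcfg).symm
  obtain ⟨kG₁, hkG₁⟩ := E₁.ι_surj G hcfg.B_ne_G.symm
  obtain ⟨kH₁, hkH₁⟩ := E₁.ι_surj H hHB
  have hE₁c : E₁.C'.arg kE₁ aE.rev = .const kE :=
    (E₁.arg_eq_const_iff kE₁ aE.rev kE).mpr (Or.inr ⟨by rw [hkE₁]; exact hEB₁, hrepl₁⟩)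
  have hE₁D : E₁.C'.arg kE₁ aE = .gate kD₁ := by
    rw [E₁.arg_eq_gate_iff, hkE₁, hkD₁]; exact Or.inl hED₁
  have hD₁G : E₁.C'.arg kD₁ aD = .gate kG₁ := by
    rw [E₁.arg_eq_gate_iff, hkD₁, hkG₁]; exact Or.inl hDG₁
  have hH₁E : E₁.C'.arg kH₁ aH = .gate kE₁ := by
    rw [E₁.arg_eq_gate_iff, hkH₁, hkE₁]; exact Or.inl hHE₁
  have hG₁t : E₁.C'.arg kG₁ aX = .var t := by rw [E₁.arg_eq_var_iff, hkG₁]; exact Or.inl hGt₁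
  have hG₁y : E₁.C'.arg kG₁ aX.rev = .var y := by rw [E₁.arg_eq_var_iff, hkG₁]; exact Or.inl hGy₁
  have hopE₁ : ∀ p q, E₁.C'.op kE₁ p q = C.op E p q := by
    intro p q; rw [elimDataWRedirectConst_op, hkE₁]; exact hopE p q
  -- step 2: `E` is trivialized
  have htrivE : E₁.C'.liveFn kE₁ aE.rev kE false = E₁.C'.liveFn kE₁ aE.rev kE true := by
    unfold liveFn at hkE ⊢
    split_ifs at hkE ⊢ with h
    · rw [hopE₁, hopE₁]; exact hkE
    · rw [hopE₁, hopE₁]; exact hkE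
  have houtE : E₁.C'.out ≠ .gate kE₁ := out_ne_of_trivialized hf (by omega) E₁.fair E₁.computes hE₁c htrivE
  let E₂ := elimDataWTriv E₁.fair E₁.computes E₁.packing hE₁c htrivE houtE hφ hI αQ
  have hrepl₂ : E₂.repl = .const (E₁.C'.liveFn kE₁ aE.rev kE false) := rfl
  have hkDE : kD₁ ≠ kE₁ := fun h => hED' (by rw [← hkE₁, ← hkD₁, h])
  have hkGE : kG₁ ≠ kE₁ := fun h => hEG (by rw [← hkE₁, ← hkG₁, h])
  have hkHE : kH₁ ≠ kE₁ := fun h => hHE' (by rw [← hkE₁, ← hkH₁, h])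
  obtain ⟨kD₂, hkD₂⟩ := E₂.ι_surj kD₁ hkDE
  obtain ⟨kG₂, hkG₂⟩ := E₂.ι_surj kG₁ hkGE
  obtain ⟨kH₂, hkH₂⟩ := E₂.ι_surj kH₁ hkHE
  have hD₂G : E₂.C'.arg kD₂ aD = .gate kG₂ := by
    rw [E₂.arg_eq_gate_iff, hkD₂, hkG₂]; exact Or.inl hD₁G
  have hG₂t : E₂.C'.arg kG₂ aX = .var t := by rw [E₂.arg_eq_var_iff, hkG₂]; exact Or.inl hG₁t
  have hG₂y : E₂.C'.arg kG₂ aX.rev = .var y := by rw [E₂.arg_eq_var_iff, hkG₂]; exact Or.inl hG₁y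
  have hH₂c : E₂.C'.arg kH₂ aH = .const (E₁.C'.liveFn kE₁ aE.rev kE false) :=
    (E₂.arg_eq_const_iff kH₂ aH _).mpr (Or.inr ⟨by rw [hkH₂]; exact hH₁E, hrepl₂⟩)
  -- out-degrees along the way
  have hfanD₁ : E₁.C'.fanout (.gate kD₁) = 1 := by
    rw [E₁.fanout_gate_eq (fun a h => ?_) (by rw [hrepl₁]; exact fun h => by cases h), hkD₁]
    · show (C.substVar x t (finTwoEquiv c')).fanout (.gate D) = 1; rw [C.fanout_substVar_gate]; exact hD1
    · rw [hwB a] at h; cases h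
  have hfanD₂ : E₂.C'.fanout (.gate kD₂) = 0 := by
    have h1 := E₂.fanout_gate_add (k' := kD₂) (by rw [hrepl₂]; exact fun h => by cases h)
    rw [hkD₂, hfanD₁] at h1
    have h2 : 1 ≤ (univ.filter fun a : Fin 2 => E₁.C'.arg kE₁ a = .gate kD₁).card :=
      card_pos.mpr ⟨aE, mem_filter.mpr ⟨mem_univ _, hE₁D⟩⟩
    omega
  have hfanG₁ : E₁.C'.fanout (.gate kG₁) = 1 := by
    rw [E₁.fanout_gate_eq (fun a h => ?_) (by rw [hrepl₁]; exact fun h => by cases h), hkG₁]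
    · show (C.substVar x t (finTwoEquiv c')).fanout (.gate G) = 1; rw [C.fanout_substVar_gate]; exact hcfg.fanout_G
    · rw [hwB a] at h; cases h
  have hfanG₂ : E₂.C'.fanout (.gate kG₂) = 1 := by
    rw [E₂.fanout_gate_eq (fun a h => ?_) (by rw [hrepl₂]; exact fun h => by cases h), hkG₂, hfanG₁]
    rcases fin2_eq_or_eq_rev aE a with e' | e'
    · rw [e', hE₁D, hkG₂] at h
      exact hcfg.D_ne_G (by have := congrArg E₁.ι (Node.gate.inj h); rw [hkD₁, hkG₁] at this; exact this)
    · rw [e', hE₁c] at h; cases h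
  -- variable out-degrees never exceed those of `C₁`, and `t` lost the two wires of `B`
  have hvf₁ : ∀ v, E₁.C'.fanout (.var v) ≤ C₁.fanout (.var v) := by
    intro v
    have h1 := E₁.fanout_var_add (i := v) (by rw [hrepl₁]; exact fun h => by cases h)
    omega
  have hvf₂ : ∀ v, E₂.C'.fanout (.var v) ≤ E₁.C'.fanout (.var v) := by
    intro v
    have h1 := E₂.fanout_var_add (i := v) (by rw [hrepl₂]; exact fun h => by cases h)
    omega
  have hft₁' : E₁.C'.fanout (.var t) = C.fanout (.var t) := by
    have h1 := E₁.fanout_var_add (i := t) (by rw [hrepl₁]; exact fun h => by cases h)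
    have h2 : (univ.filter fun a : Fin 2 => C₁.arg B a = .var t).card = 2 := by
      rw [Finset.card_eq_two]
      refine ⟨0, 1, by decide, ?_⟩
      ext a; rw [mem_filter, mem_insert, mem_singleton]
      constructor
      · intro _; rcases fin2_eq_or_eq_rev 0 a with e' | e'
        · exact Or.inl e'
        · right; rw [e']; rfl
      · intro _; exact ⟨mem_univ _, hwB a⟩
    rw [h2, hfant₁] at h1
    omega
  -- step 3: delete the `0`-gate `D`
  have houtD₂ : E₂.C'.out ≠ .gate kD₂ := by
    intro hh
    have h1 := E₁.out_eq; rw [if_neg houtB, hC₁out] at h1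
    have h2 := E₂.out_eq; rw [if_neg houtE, hh] at h2
    change Node.gate (E₂.ι kD₂) = E₁.C'.out at h2
    rw [hkD₂] at h2
    have := congrArg (Node.embed E₁.ι) h2
    rw [h1] at this
    change Node.gate (E₁.ι kD₁) = Node.gate ko at this
    rw [hkD₁] at this; cases this; exact hDout hko
  have hno₃ : ∀ k a, E₂.C'.arg k a ≠ .gate kD₂ := (fanout_eq_zero_iff _ _).mp hfanD₂
  let ε₃ := E₂.C'.skipEquiv kD₂
  let C₃ := E₂.C'.removeGate kD₂ ε₃
  have hF₃ : C₃.Fair := E₂.fair.removeGate ε₃ hno₃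
  have hC₃ : C₃.ComputesRestr f R₁ := E₂.computes.removeGate ε₃ E₂.fair hno₃ houtD₂
  have hvarD : ∀ a v, E₂.C'.arg kD₂ a = .var v → E₂.C'.fanout (.var v) ≤ 2 := by
    intro a v hv
    rcases fin2_eq_or_eq_rev aD a with e' | e'
    · rw [e', hD₂G] at hv; cases hv
    · -- the wire is `u` (or `t` if `u = t`)
      rw [e', E₂.arg_eq_var_iff, hkD₂] at hv
      rcases hv with hv | ⟨-, hv⟩
      swap; · rw [hrepl₂] at hv; cases hv
      rw [E₁.arg_eq_var_iff, hkD₁] at hv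
      rcases hv with hv | ⟨-, hv⟩
      swap; · rw [hrepl₁] at hv; cases hv
      -- `hv : C₁.arg D aD.rev = var v`
      have hvx : v ≠ x := fun h => by
        rw [h] at hv; exact Node.substVar_ne_var_self (fun h' => hxt h'.symm) _ hv
      by_cases hvt : v = t
      · rw [hvt]
        have h1 := hvf₂ t; rw [hft₁'] at h1
        have h2 := one_le_fanout_of_arg_eq (C := C) hEB
        omega
      · rw [hvar₁ D aD.rev v hvx hvt] at hv
        rw [hIu] at hv; cases hv
        have e1 : C₁.fanout (.var u) = C.fanout (.var u) := by
          show (C.substVar x t (finTwoEquiv c')).fanout (.var u) = _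
          exact C.fanout_substVar_var_of_ne x t _ hux hvt
        have := hvf₁ u; have := hvf₂ u; omega
  have hgateD : ∀ a g, E₂.C'.arg kD₂ a = .gate g → E₂.C'.fanout (.gate g) ≤ 1 := by
    intro a g hg
    rcases fin2_eq_or_eq_rev aD a with e' | e'
    · rw [e', hD₂G] at hg; cases hg; omega
    · rw [e', E₂.arg_eq_gate_iff, hkD₂] at hg
      rcases hg with hg | ⟨-, hg⟩
      swap; · rw [hrepl₂] at hg; cases hg
      rw [E₁.arg_eq_gate_iff, hkD₁] at hg
      rcases hg with hg | ⟨-, hg⟩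
      swap; · rw [hrepl₁] at hg; cases hg
      rw [hgate₁, hIu] at hg
      cases hg
  obtain ⟨P₃, hP₃, hpot₃⟩ := exists_packing_removeGate_noNew E₂.C' kD₂ ε₃ hno₃ E₂.packing hvarD hgateD
  have hvf₃ : ∀ v, C₃.fanout (.var v) ≤ E₂.C'.fanout (.var v) := by
    intro v
    have h1 := E₂.C'.fanout_removeGate_add kD₂ ε₃ hno₃ (v := .var v) (fun h => by cases h)
    change C₃.fanout (.var v) + _ = _ at h1
    omega
  -- step 4: delete the `0`-gate `G`
  have hkGD₂ : kG₂ ≠ kD₂ := fun h => hcfg.D_ne_G (by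
    have := congrArg E₂.ι h; rw [hkG₂, hkD₂] at this
    have := congrArg E₁.ι this; rw [hkG₁, hkD₁] at this; exact this.symm)
  have hkHD₂ : kH₂ ≠ kD₂ := fun h => hHD (by
    have := congrArg E₂.ι h; rw [hkH₂, hkD₂] at this
    have := congrArg E₁.ι this; rw [hkH₁, hkD₁] at this; exact this)
  let kG₃ : Fin _ := ε₃.symm ⟨kG₂, hkGD₂⟩
  let kH₃ : Fin _ := ε₃.symm ⟨kH₂, hkHD₂⟩
  have hεG : (ε₃ kG₃ : Fin E₂.C'.m) = kG₂ := by
    show ((ε₃ (ε₃.symm ⟨kG₂, hkGD₂⟩)) : Fin E₂.C'.m) = kG₂; rw [Equiv.apply_symm_apply ε₃]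
  have hεH : (ε₃ kH₃ : Fin E₂.C'.m) = kH₂ := by
    show ((ε₃ (ε₃.symm ⟨kH₂, hkHD₂⟩)) : Fin E₂.C'.m) = kH₂; rw [Equiv.apply_symm_apply ε₃]
  have hG₃0 : C₃.fanout (.gate kG₃) = 0 := by
    have h1 := E₂.C'.fanout_removeGate_add kD₂ ε₃ hno₃ (v := .gate kG₂) (fun h => hkGD₂ (Node.gate.inj h))
    have hskip : (Node.gate kG₂ : Node n E₂.C'.m).skip kD₂ ε₃ = .gate kG₃ := Node.skip_gate_of_ne kD₂ ε₃ hkGD₂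
    rw [hskip, hfanG₂] at h1
    have h2 : 1 ≤ (univ.filter fun a : Fin 2 => E₂.C'.arg kD₂ a = .gate kG₂).card :=
      card_pos.mpr ⟨aD, mem_filter.mpr ⟨mem_univ _, hD₂G⟩⟩
    change C₃.fanout (.gate kG₃) + _ = _ at h1
    omega
  have hG₃t : C₃.arg kG₃ aX = .var t := by
    show (E₂.C'.arg (ε₃ kG₃) aX).skip kD₂ ε₃ = .var t; rw [hεG, hG₂t]; rfl
  have hG₃y : C₃.arg kG₃ aX.rev = .var y := by
    show (E₂.C'.arg (ε₃ kG₃) aX.rev).skip kD₂ ε₃ = .var y; rw [hεG, hG₂y]; rfl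
  have hH₃c : C₃.arg kH₃ aH = .const (E₁.C'.liveFn kE₁ aE.rev kE false) := by
    show (E₂.C'.arg (ε₃ kH₃) aH).skip kD₂ ε₃ = _; rw [hεH, hH₂c]; rfl
  have houtG₃ : C₃.out ≠ .gate kG₃ := by
    intro h
    change E₂.C'.out.skip kD₂ ε₃ = .gate kG₃ at h
    rw [Node.skip_eq_gate_iff, hεG] at h
    -- `E₂.out = gate kG₂` traces back to `C.out = gate G`
    have h1 := E₁.out_eq; rw [if_neg houtB, hC₁out] at h1
    have h2 := E₂.out_eq; rw [if_neg houtE, h] at h2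
    change Node.gate (E₂.ι kG₂) = E₁.C'.out at h2
    rw [hkG₂] at h2
    have := congrArg (Node.embed E₁.ι) h2
    rw [h1] at this
    change Node.gate (E₁.ι kG₁) = Node.gate ko at this
    rw [hkG₁] at this; cases this; exact hGout hko
  have hno₄ : ∀ k a, C₃.arg k a ≠ .gate kG₃ := (fanout_eq_zero_iff _ _).mp hG₃0
  let ε₄ := C₃.skipEquiv kG₃
  let C₄ := C₃.removeGate kG₃ ε₄
  have hF₄ : C₄.Fair := hF₃.removeGate ε₄ hno₄
  have hC₄ : C₄.ComputesRestr f R₁ := hC₃.removeGate ε₄ hF₃ hno₄ houtG₃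
  have hy₁ : C₁.fanout (.var y) = 2 := by
    show (C.substVar x t (finTwoEquiv c')).fanout (.var y) = 2
    rw [C.fanout_substVar_var_of_ne x t _ (fun h => hcfg.x_ne_y h.symm) (fun h => hty h.symm)]; exact hcfg.fanout_y
  have hvarG : ∀ a v, C₃.arg kG₃ a = .var v → C₃.fanout (.var v) ≤ 2 := by
    intro a v hv
    rcases fin2_eq_or_eq_rev aX a with e' | e'
    · rw [e', hG₃t] at hv; cases hv
      have h1 := hvf₃ t; have h2 := hvf₂ t; rw [hft₁'] at h2
      have h3 := one_le_fanout_of_arg_eq (C := C) hEB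
      omega
    · rw [e', hG₃y] at hv; cases hv
      have h1 := hvf₃ y; have h2 := hvf₂ y; have h3 := hvf₁ y
      omega
  have hgateG : ∀ a g, C₃.arg kG₃ a = .gate g → C₃.fanout (.gate g) ≤ 1 := by
    intro a g hg
    rcases fin2_eq_or_eq_rev aX a with e' | e'
    · rw [e', hG₃t] at hg; cases hg
    · rw [e', hG₃y] at hg; cases hg
  obtain ⟨P₄, hP₄, hpot₄⟩ := exists_packing_removeGate_noNew C₃ kG₃ ε₄ hno₄ hP₃ hvarG hgateG
  -- step 5: the reader `H` of `E` is fed by a constant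
  have hkHG₃ : kH₃ ≠ kG₃ := by
    intro h
    have : (ε₃ kH₃ : Fin E₂.C'.m) = (ε₃ kG₃ : Fin E₂.C'.m) := by rw [h]
    rw [hεH, hεG] at this
    have := congrArg E₂.ι this; rw [hkH₂, hkG₂] at this
    have := congrArg E₁.ι this; rw [hkH₁, hkG₁] at this
    exact hHG this
  have hcount : 1 ≤ C₄.constFedCount := by
    unfold constFedCount
    refine card_pos.mpr ⟨ε₄.symm ⟨kH₃, hkHG₃⟩, mem_filter.mpr ⟨mem_univ _, aH, E₁.C'.liveFn kE₁ aE.rev kE false, ?_⟩⟩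
    show (C₃.arg (ε₄ (ε₄.symm ⟨kH₃, hkHG₃⟩)) aH).skip kG₃ ε₄ = .const (E₁.C'.liveFn kE₁ aE.rev kE false)
    rw [Equiv.apply_symm_apply ε₄]
    show (C₃.arg kH₃ aH).skip kG₃ ε₄ = _
    rw [hH₃c]; rfl
  obtain ⟨D', P', hF', hCD', hP', hm', hμ'⟩ := cascade hf hd₁ hφ hI αQ 1 C₄ P₄ hF₄ hC₄ hP₄ hcount
  -- accounting
  have hinf₁ : ((C₁.influential R₁).card : ℝ) + 1 ≤ (C.influential R).card := by
    have hfreej : ¬ R₁.Free x := fun h => ((hfree x).mp h).2 rfl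
    have hprot : ∀ i, R₁.Protected i → R.Protected i := fun i h => (RdqSource.protected_assignLin_iff hx hxp hEq i).mp h
    have h1 := C.influential_substVar_subset x t (finTwoEquiv c') (fun h => hxt h.symm) hfreej hprot
    have h2 : insert t ((C.influential R).erase x) = (C.influential R).erase x :=
      insert_eq_of_mem (mem_erase.mpr ⟨fun h => hxt h.symm, htinf⟩)
    rw [h2] at h1
    have h3 := card_le_card h1
    change (C₁.influential R₁).card ≤ _ at h3
    have h4 := card_erase_add_one hxinf
    have : (C₁.influential R₁).card + 1 ≤ (C.influential R).card := by omega
    exact_mod_cast this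
  have hq : (R₁.quadCount : ℝ) = R.quadCount := rfl
  have hμ₁ : C₁.measure αφ αI αQ P₁ R₁ ≤ C.measure αφ αI αQ ∅ R - αI := by
    unfold measure
    rw [hq]
    show ((C.m : ℕ) : ℝ) + _ + _ + _ ≤ _
    nlinarith [mul_le_mul_of_nonneg_left hinf₁ hI, mul_le_mul_of_nonneg_left hpot₁ hφ]
  have hμE₁ := E₁.measure_le
  have hμE₂ := E₂.measure_le
  have hinf₃ : ((C₃.influential R₁).card : ℝ) ≤ (E₂.C'.influential R₁).card := by
    exact_mod_cast card_le_card (E₂.C'.influential_removeGate_subset kD₂ ε₃ hno₃ R₁)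
  have hinf₄ : ((C₄.influential R₁).card : ℝ) ≤ (C₃.influential R₁).card := by
    exact_mod_cast card_le_card (C₃.influential_removeGate_subset kG₃ ε₄ hno₄ R₁)
  have hm₃ := E₂.C'.removeGate_m_add_one kD₂ ε₃
  have hm₄ := C₃.removeGate_m_add_one kG₃ ε₄
  have hm₃' : (C₃.m : ℝ) + 1 = E₂.C'.m := by exact_mod_cast hm₃
  have hm₄' : (C₄.m : ℝ) + 1 = C₃.m := by exact_mod_cast hm₄
  have hμ₃ : C₃.measure αφ αI αQ P₃ R₁ ≤ E₂.C'.measure αφ αI αQ E₂.P' R₁ - 1 := by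
    unfold measure
    have hp : (C₃.potential P₃ : ℝ) ≤ E₂.C'.potential E₂.P' := by exact_mod_cast hpot₃
    nlinarith [mul_le_mul_of_nonneg_left hinf₃ hI, mul_le_mul_of_nonneg_left hp hφ]
  have hμ₄ : C₄.measure αφ αI αQ P₄ R₁ ≤ C₃.measure αφ αI αQ P₃ R₁ - 1 := by
    unfold measure
    have hp : (C₄.potential P₄ : ℝ) ≤ C₃.potential P₃ := by exact_mod_cast hpot₄
    nlinarith [mul_le_mul_of_nonneg_left hinf₄ hI, mul_le_mul_of_nonneg_left hp hφ]
  refine Or.inr ⟨1, le_rfl, by norm_num, D', R₁, P', hF', hCD', hP', RdqSource.dim_assignLin hx hxp hEq, ?_⟩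
  have hδ := liYangDelta_le_case3 αφ αI αQ
  push_cast at hμ'
  simp only [Nat.cast_one, mul_one]
  linarith

end Semicircuit

end Literature.Computability.Complexity
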